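import Summits.ResolutionOfSingularities.ResolutionOfSingularities.Theorems.RadicialJungCleanModelsSufficeGameCountE
import Summits.ResolutionOfSingularities.ResolutionOfSingularities.Theorems.RadicialJungCleanModelsSufficeGameCharge

/-!
# Route `RadicialJung`, crux `CleanModelsSuffice`, line `Sketch`: the exceptionalisation game —
# (F) the measure `mOld` near a point, and germs of loci that are locally coordinate subspaces

Helper for the registered stubs `stub_gameCentre1` / `stub_gameCentre2` of the skeleton of
`Summit.ResolutionOfSingularities.ResolutionOfSingularities.Theses.RadicialJung.CleanModelsSuffice`
(stmt-ResolutionOfSingularities-15883). For a general game state `S` and a point `v`: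

* `card_oldCh_add_card_filter_isLab`, `card_filter_isLab_eq_card_charged` — (i)
  `|ch w| = mOld w + #{D ∈ E charged at w}` (the labelling is injective);
* `exists_nhds_chargedAt_iff_gen` — near `v`, an exceptional divisor `D` through `v` is charged at
  `w` iff it is charged at `v` and `η_{lab D} ⤳ w` (charge constancy `…GameCharge` + `D ∩ U =
  cl(η_{lab D}) ∩ U`, `…GameCount`); `exists_nhds_card_charged_eq` — hence
  `#{D charged at w} = #{i ∈ ch v labelled | η_i ⤳ w}`;
* `exists_nhds_mOld_eq` — (ii) near `v`, whenever `|ch w| ≥ 2` or at least two of the `η_i`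
  (`i ∈ ch v`) specialise to `w`: `mOld w = #{i ∈ oldCh v | η_i ⤳ w}` (with the intrinsic count
  `…GameCountE`);
* `stalkIdeal_vanishingIdeal_eq_span_of_nhds` — (iii) if a closed `Z` agrees near `v` with
  `cl(η_t)`, then `I(Z)_v = (u_i : i ∈ t)`.
-/

noncomputable section

set_option linter.dupNamespace false -- mandated namespace of this single-conjunct summit

open CategoryTheory AlgebraicGeometry TopologicalSpace IsLocalRing
open Literature.AlgebraicGeometry.Resolution Literature.AlgebraicGeometry.Motives
open Summit.ResolutionOfSingularities.ResolutionOfSingularities.Theorems.Picover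

namespace Summit.ResolutionOfSingularities.ResolutionOfSingularities.Theorems.RadicialJung.CleanModelsSuffice

attribute [local instance] stalkAlgebra isScalarTower_stalkAlgebra

namespace GameState

variable {p : ℕ} {V₀ : Scheme.{0}} [IsIntegral V₀] {L : Type} [Field L] [Algebra V₀.functionField L]
  {V : Scheme.{0}} [IsIntegral V] {π : V ⟶ V₀} [IsDominant π]
  (S : GameState p V₀ L V π)

/-! ## (i) Finite bookkeeping on the labels -/

open Classical in
/-- `|oldCh w| + #{charged labelled coordinates at w} = |ch w|`. [folklore] -/
theorem card_oldCh_add_card_filter_isLab (w : V) :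
    (S.oldCh w).card + ((S.ch w).filter fun i => S.IsLab w i).card = (S.ch w).card := by
  classical
  rw [GameState.oldCh, add_comm]
  convert Finset.card_filter_add_card_filter_not (s := S.ch w) (p := fun i => S.IsLab w i)

/-- `D` is charged at `w` iff `D ∈ E`, `w ∈ D` and the coordinate labelled by `D` is charged.
[folklore] -/
theorem chargedAt_iff_a_lab_ne_zero (S : GameState p V₀ L V π) (D : V.IdealSheafData) (w : V)
    (hD : D ∈ S.E ∧ w ∈ D.support) : S.chargedAt D w ↔ S.a w (S.lab w ⟨D, hD⟩) ≠ 0 := by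
  unfold GameState.chargedAt GameState.expOf
  rw [dif_pos hD]

open Classical in
/-- The charged labelled coordinates at `w` are in bijection with the exceptional divisors charged
at `w` (by the injective labelling): `#{i ∈ ch w labelled} = #{D ∈ E charged at w}`. [folklore] -/
theorem card_filter_isLab_eq_card_charged (w : V) :
    ((S.ch w).filter fun i => S.IsLab w i).card =
      (S.E.toFinset.filter fun D => S.chargedAt D w).card := by
  classical
  have hmemch : ∀ i, i ∈ S.ch w ↔ S.a w i ≠ 0 := fun i => by simp [GameState.ch]
  symm
  refine Finset.card_bij (fun D hD => S.lab w ⟨D, List.mem_toFinset.mp (Finset.mem_filter.mp hD).1,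
      S.mem_support_of_chargedAt (Finset.mem_filter.mp hD).2⟩) (fun D hD => ?_)
      (fun D hD D' hD' h => ?_) (fun i hi => ?_)
  · obtain ⟨hDE, hch⟩ := Finset.mem_filter.mp hD
    refine Finset.mem_filter.mpr ⟨(hmemch _).mpr ?_, ⟨_, rfl⟩⟩
    exact (S.chargedAt_iff_a_lab_ne_zero D w _).mp hch
  · exact congrArg Subtype.val (S.lab_injective w h)
  · obtain ⟨hich, ⟨D, hDi⟩⟩ := Finset.mem_filter.mp hi
    have hch : S.chargedAt D.1 w := by
      rw [S.chargedAt_iff_a_lab_ne_zero D.1 w D.2]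
      have : S.lab w ⟨D.1, D.2⟩ = i := hDi
      rw [this]
      exact (hmemch i).mp hich
    exact ⟨D.1, Finset.mem_filter.mpr ⟨List.mem_toFinset.mpr D.2.1, hch⟩, hDi⟩

/-! ## (ii) The measures near a point -/

section Near

variable [Algebra V.functionField L]
  (hp : p.Prime) (k : Type) [Field k] [CharP k p] (f : V ⟶ Spec (.of k)) [LocallyOfFiniteType f]
  (hdegV : Module.finrank V.functionField L = p)
  (hrange : Set.range (algebraMap V.functionField L) = Set.range (algebraMap V₀.functionField L))
  (hcompat : ∀ g : V₀.functionField,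
    algebraMap V.functionField L (RatFn.functionFieldMap π g) = algebraMap V₀.functionField L g)

include hp f hdegV hrange hcompat in
open Classical in
/-- **Charge of an exceptional divisor near `v`**: there is an open `U ∋ v` meeting only the
members of `E` through `v`, such that for `w ∈ U` and `D ∈ E` through `v`:
`D charged at w ↔ (D charged at v ∧ η_{lab D} ⤳ w)` (charge constancy,
`exists_nhds_chargedAt_iff_of_compat`, and `D ∩ U = cl(η_{lab D}) ∩ U`,
`exists_nhds_mem_support_iff`). [folklore] -/
theorem exists_nhds_chargedAt_iff_gen (v : V) :
    ∃ U : V.Opens, v ∈ U ∧ ∀ w ∈ U,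
      (∀ D ∈ S.E, w ∈ D.support → v ∈ D.support) ∧
      (∀ (D : V.IdealSheafData) (hD : D ∈ S.E ∧ v ∈ D.support),
        (w ∈ D.support ↔ S.gen v {S.lab v ⟨D, hD⟩} ⤳ w) ∧
        (S.chargedAt D w ↔ (S.chargedAt D v ∧ S.gen v {S.lab v ⟨D, hD⟩} ⤳ w))) := by
  obtain ⟨U₂, hvU₂, hU₂⟩ := S.exists_nhds_mem_support_iff k f v
  obtain ⟨U₃, hvU₃, hU₃⟩ := S.exists_nhds_chargedAt_iff_of_compat hrange hcompat hp k f hdegV v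
  refine ⟨U₂ ⊓ U₃, ⟨hvU₂, hvU₃⟩, fun w hw => ⟨(hU₂ w hw.1).1, fun D hD => ⟨(hU₂ w hw.1).2 D hD, ?_⟩⟩⟩
  rw [← (hU₂ w hw.1).2 D hD]
  constructor
  · intro hch
    have hwD := S.mem_support_of_chargedAt hch
    exact ⟨((hU₃ w hw.2 D hD.1).2 hwD).mp hch, hwD⟩
  · rintro ⟨hch, hwD⟩
    exact ((hU₃ w hw.2 D hD.1).2 hwD).mpr hch

include hp f hdegV hrange hcompat in
open Classical in
/-- **The number of exceptional divisors charged at `w`, near `v`**: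
`#{D ∈ E charged at w} = #{i ∈ ch v labelled | η_i ⤳ w}`. [folklore] -/
theorem exists_nhds_card_charged_eq (v : V) :
    ∃ U : V.Opens, v ∈ U ∧ ∀ w ∈ U,
      (S.E.toFinset.filter fun D => S.chargedAt D w).card =
        ((S.ch v).filter fun i => S.IsLab v i ∧ S.gen v {i} ⤳ w).card := by
  classical
  have hmemch : ∀ i, i ∈ S.ch v ↔ S.a v i ≠ 0 := fun i => by simp [GameState.ch]
  obtain ⟨U, hvU, hU⟩ := S.exists_nhds_chargedAt_iff_gen hp k f hdegV hrange hcompat v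
  refine ⟨U, hvU, fun w hw => ?_⟩
  -- charged at `w` ⇒ through `v`
  have hthrough : ∀ D, S.chargedAt D w → D ∈ S.E ∧ v ∈ D.support := fun D hch =>
    ⟨S.mem_E_of_chargedAt hch, (hU w hw).1 D (S.mem_E_of_chargedAt hch) (S.mem_support_of_chargedAt hch)⟩
  refine Finset.card_bij (fun D hD => S.lab v ⟨D, hthrough D (Finset.mem_filter.mp hD).2⟩)
    (fun D hD => ?_) (fun D hD D' hD' h => ?_) (fun i hi => ?_)
  · have hch := (Finset.mem_filter.mp hD).2
    obtain ⟨hchv, hgen⟩ := ((hU w hw).2 D (hthrough D hch)).2.mp hch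
    refine Finset.mem_filter.mpr ⟨(hmemch _).mpr ?_, ⟨_, rfl⟩, hgen⟩
    exact (S.chargedAt_iff_a_lab_ne_zero D v _).mp hchv
  · exact congrArg Subtype.val (S.lab_injective v h)
  · obtain ⟨hich, ⟨D, hDi⟩, hgen⟩ := Finset.mem_filter.mp hi
    have hchv : S.chargedAt D.1 v := by
      rw [S.chargedAt_iff_a_lab_ne_zero D.1 v D.2]
      have : S.lab v ⟨D.1, D.2⟩ = i := hDi
      rw [this]
      exact (hmemch i).mp hich
    have hch : S.chargedAt D.1 w := ((hU w hw).2 D.1 D.2).2.mpr ⟨hchv, by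
      have : S.lab v ⟨D.1, D.2⟩ = i := hDi
      rw [this]; exact hgen⟩
    exact ⟨D.1, Finset.mem_filter.mpr ⟨List.mem_toFinset.mpr D.2.1, hch⟩, hDi⟩

include hp f hdegV hrange hcompat in
open Classical in
/-- **(ii) The measure `mOld` near `v`.** There is an open `U ∋ v` such that for `w ∈ U` with
`|ch w| ≥ 2`, or with at least two of the `η_i` (`i ∈ ch v`) specialising to `w`:
`mOld w = #{i ∈ oldCh v | η_i ⤳ w}`. (`|ch w| = mOld w + #{D charged at w}`,
`#{D charged at w} = #{i ∈ ch v labelled | η_i ⤳ w}`, and the intrinsic count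
`|ch w| = #{i ∈ ch v | η_i ⤳ w}`.) [folklore] -/
theorem exists_nhds_mOld_eq (v : V) :
    ∃ U : V.Opens, v ∈ U ∧ ∀ w ∈ U,
      (2 ≤ (S.ch w).card ∨ 2 ≤ ((S.ch v).filter fun i => S.gen v {i} ⤳ w).card) →
        S.mOld w = ((S.oldCh v).filter fun i => S.gen v {i} ⤳ w).card := by
  classical
  obtain ⟨U₁, hvU₁, hU₁⟩ := S.exists_nhds_card_ch_eq hp k f hdegV hrange hcompat v
  obtain ⟨U₂, hvU₂, hU₂⟩ := S.exists_nhds_card_charged_eq hp k f hdegV hrange hcompat v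
  refine ⟨U₁ ⊓ U₂, ⟨hvU₁, hvU₂⟩, fun w hw h2 => ?_⟩
  have hcount := hU₁ w hw.1 h2
  have hN := hU₂ w hw.2
  have hsum := S.card_oldCh_add_card_filter_isLab w
  rw [S.card_filter_isLab_eq_card_charged w, hN] at hsum
  -- split `{i ∈ ch v | η_i ⤳ w}` by labels: `oldCh v = ch v ∖ labels`
  have hsplit := Finset.card_filter_add_card_filter_not
    (s := (S.ch v).filter fun i => S.gen v {i} ⤳ w) (p := fun i => S.IsLab v i)
  rw [Finset.filter_filter, Finset.filter_filter] at hsplit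
  have hb : ((S.ch v).filter fun i => S.gen v {i} ⤳ w ∧ S.IsLab v i) =
      (S.ch v).filter fun i => S.IsLab v i ∧ S.gen v {i} ⤳ w :=
    Finset.filter_congr fun i _ => and_comm
  have ho : ((S.ch v).filter fun i => S.gen v {i} ⤳ w ∧ ¬ S.IsLab v i) =
      (S.oldCh v).filter fun i => S.gen v {i} ⤳ w := by
    rw [GameState.oldCh, Finset.filter_filter]
    exact Finset.filter_congr fun i _ => and_comm
  rw [hb, ho] at hsplit
  change (S.oldCh w).card = _
  omega

end Near

/-! ## (iii) Germs of loci that are locally closures of coordinate generisations -/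

/-- **(iii)** If a closed `Z ⊆ V` agrees, on an open neighbourhood of `v`, with the closure of the
generisation `η_t` (`w ∈ Z ↔ η_t ⤳ w`), then the germ of its ideal at `v` is the coordinate prime
`(u_i : i ∈ t)` (`stalkIdeal_vanishingIdeal_eq_vanishingIdeal_setOf`: the trace on `Spec 𝒪_{V,v}`
is `V(u_t)`, whose vanishing ideal is the prime `(u_t)`). [folklore] -/
theorem stalkIdeal_vanishingIdeal_eq_span_of_nhds (v : V) (t : Finset (Fin (S.d v))) {Z : Set V}
    (hZ : IsClosed Z) (U : V.Opens) (hvU : v ∈ U) (hU : ∀ w ∈ U, w ∈ Z ↔ S.gen v t ⤳ w) :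
    stalkIdeal (Scheme.IdealSheafData.vanishingIdeal ⟨Z, hZ⟩) v =
      Ideal.span (S.u v '' (t : Set (Fin (S.d v)))) := by
  rw [stalkIdeal_vanishingIdeal_eq_vanishingIdeal_setOf]
  have hset : {q : PrimeSpectrum (V.presheaf.stalk v) |
      V.fromSpecStalk v q ∈ ((⟨Z, hZ⟩ : Closeds V) : Set V)} =
      PrimeSpectrum.zeroLocus (S.u v '' (t : Set (Fin (S.d v)))) := by
    ext q
    rw [Set.mem_setOf_eq, PrimeSpectrum.mem_zeroLocus, Set.image_subset_iff]
    change V.fromSpecStalk v q ∈ Z ↔ _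
    rw [hU _ ((fromSpecStalk_specializes q).mem_open U.isOpen hvU),
      GameState.gen_specializes_fromSpecStalk_iff]
    exact ⟨fun h i hi => h i (Finset.mem_coe.mp hi), fun h i hi => h (Finset.mem_coe.mpr hi)⟩
  rw [hset, ← PrimeSpectrum.zeroLocus_span, PrimeSpectrum.vanishingIdeal_zeroLocus_eq_radical]
  exact (S.isPrime_span_image v t).radical

end GameState

end Summit.ResolutionOfSingularities.ResolutionOfSingularities.Theorems.RadicialJung.CleanModelsSuffice

end
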